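import Summits.Ventures.QEC.Census.RefinedIPCertificateLemmas
import HarnessLib

/-!
# Refined certificates: weak duality, soundness, and the assembly of CRSS's two-stage special-bound argument

Venture QEC (cell `qec`, rung X1; row 06). Third of three files implementing certificates for CRSS's linear program
refined with respect to a codeword [CalderbankEtAl1998, §7 (ii)]: `not_leafHyp_of_rleafOK` (a refined leaf that
checks refutes every solution of the plain + refined integer system on its branch — weak duality with the
family-structured multipliers), `not_crssRefinedFeasible_of_check` (two checked `RTree`s, one per parity branch,
refute `CRSSRefinedFeasible n k d w₀`), and the ASSEMBLY `no_additiveCode_of_certs`: plain certificates with the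
extra rows `A_w = 0 (w ∈ zs)` («linear programming shows that `C` must contain a vector of weight 12») + refined
certificates for every `w ∈ zs` («adding these constraints to the refined weight enumerator produces a linear program
with no feasible solution») ⇒ no `[[n,k,d]]` additive code without weight-one stabilizer words; with Thm. 6 (e) the
column step `not_additiveCodeExists_succ_of_certs`. HONEST FRAMING: nonexistence only; nothing here certifies a
distance; per-cell certificates are DATA files `Census/IPBounds/…`. [cite: CalderbankEtAl1998, §7 (ii) (printed
p. 28)]; [cite: MacWilliamsSloane1977, Ch. 17 §4 Thm. 20].
-/

namespace Summit.Ventures.QEC.Census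

open Finset Literature.InformationTheory.QuantumCodes

section Soundness

variable {n k d e w₀ : ℕ} {A B W : ℕ → ℕ} {R Rp : ℕ → ℕ → ℕ → ℕ}


/-- **Weak duality for a refined leaf**: a leaf that checks refutes every `(A,B,W,R,R')` satisfying the bundled
hypotheses. Column: proved (ours). [cite: MacWilliamsSloane1977, Ch. 17 §4 Thm. 20] -/
theorem not_leafHyp_of_rleafOK {path : List RSplit} {L : RLeaf} (h : rleafOK n k d e w₀ path L = true)
    (H : LeafHyp n k d e w₀ path A B W R Rp) : False := by
  have hsys := H.sys
  have href := H.ref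
  obtain ⟨-, h0, h1, hsum, hpar, hB, hW, heq, hle, hBW, hpure⟩ := hsys
  obtain ⟨hmR, hmRp, hid, hodd, hsup, htr, hcont, hceq, hz0, hzu⟩ := href
  simp only [rleafOK, Bool.and_eq_true, List.all_eq_true, List.mem_range, decide_eq_true_eq, Bool.or_eq_true,
    Bool.not_eq_true', decide_eq_false_iff_not] at h
  obtain ⟨⟨⟨⟨⟨hwn, hsig⟩, hssig⟩, hABW⟩, hRRp⟩, hrhs⟩ := h
  -- (1) the base rows: `combRhs ≤ Σ_j (combA A + combB B + combW W)`
  have hbase := combRhs_le (n := n) (A := A) (B := B) (W := W) (baseRows n k d e) L.base hsig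
    (sat_baseRows (n := n) h0 h1 hsum hpar hB hW heq hle hBW hpure)
  -- (2) the split rows
  have hspl := splitRhs_le (n := n) (w₀ := w₀) (A := A) (B := B) (W := W) (R := R) (Rp := Rp) path L.smult hssig H.path
  -- (3) marginal rows: `Σ_j λ_j (Σ_tri R − A_j) = 0`
  have hmarg : ∀ (lam : List ℤ) (X : ℕ → ℕ → ℕ → ℕ) (T : ℕ → ℕ),
      (∀ j, j ≤ n → boxSum n w₀ (fun a b c => if b + c ≤ w₀ ∧ a + b + c = j then (X a b c : ℤ) else 0) = T j) →
      boxSum n w₀ (fun a b c => (if b + c ≤ w₀ then lam.getD (a + b + c) 0 else 0) * (X a b c : ℤ)) =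
        ∑ j ∈ range (n + 1), lam.getD j 0 * (T j : ℤ) := by
    intro lam X T hT
    calc boxSum n w₀ (fun a b c => (if b + c ≤ w₀ then lam.getD (a + b + c) 0 else 0) * (X a b c : ℤ))
        = boxSum n w₀ (fun a b c => ∑ j ∈ range (n + 1),
            lam.getD j 0 * (if b + c ≤ w₀ ∧ a + b + c = j then (X a b c : ℤ) else 0)) := by
          unfold boxSum
          refine Finset.sum_congr rfl fun a ha => Finset.sum_congr rfl fun b _ => Finset.sum_congr rfl fun c _ => ?_
          beta_reduce
          by_cases htri : b + c ≤ w₀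
          · have hwt : a + b + c ∈ range (n + 1) := mem_range.2 (by have := mem_range.1 ha; omega)
            simp only [htri, ↓reduceIte, true_and, mul_ite, mul_zero]
            rw [Finset.sum_ite_eq, if_pos hwt]
          · simp [htri]
      _ = ∑ j ∈ range (n + 1), lam.getD j 0 *
            boxSum n w₀ (fun a b c => if b + c ≤ w₀ ∧ a + b + c = j then (X a b c : ℤ) else 0) := by
          rw [boxSum_finset_sum]
          exact Finset.sum_congr rfl fun j _ => boxSum_mul n w₀ _ _
      _ = ∑ j ∈ range (n + 1), lam.getD j 0 * (T j : ℤ) :=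
          Finset.sum_congr rfl fun j hj => by rw [hT j (Nat.lt_succ_iff.1 (mem_range.1 hj))]
  have hmargR := hmarg L.lamR R A (fun j hj => margR_tri H.ref hj)
  have hmargRp := hmarg L.lamRp Rp B (fun j hj => margRp_tri H.ref hj)
  -- (4) evaluation points
  have hpts := pts_identity H.ref L.pts
  -- (5) zero rows
  have hzero : boxSum n w₀ (fun a b c => (if Odd c ∨ w₀ < b + c then get3 L.zR a b c else 0) * (R a b c : ℤ) +
      (if Odd c ∨ w₀ < b + c then get3 L.zRp a b c else 0) * (Rp a b c : ℤ)) = 0 := by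
    unfold boxSum
    refine Finset.sum_eq_zero fun a _ => Finset.sum_eq_zero fun b _ => Finset.sum_eq_zero fun c _ => ?_
    beta_reduce
    by_cases hc : Odd c ∨ w₀ < b + c
    · have hR0 : R a b c = 0 := by
        rcases hc with hc | hc
        · exact (hodd a b c hc).1
        · exact (hsup a b c (Or.inr hc)).1
      have hRp0 : Rp a b c = 0 := by
        rcases hc with hc | hc
        · exact (hodd a b c hc).2
        · exact (hsup a b c (Or.inr hc)).2
      rw [hR0, hRp0]; simp
    · simp [hc]
  -- (6) translation rows
  have htrans : boxSum n w₀ (fun a b c =>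
      (if b + c ≤ w₀ then get3 L.tR a b c - get3 L.tR a (w₀ - b - c) c else 0) * (R a b c : ℤ) +
      (if b + c ≤ w₀ then get3 L.tRp a b c - get3 L.tRp a (w₀ - b - c) c else 0) * (Rp a b c : ℤ)) = 0 := by
    have e1 : boxSum n w₀ (fun a b c => if b + c ≤ w₀ then get3 L.tR a b c * (R a (w₀ - b - c) c : ℤ) else 0) =
        boxSum n w₀ (fun a b c => if b + c ≤ w₀ then get3 L.tR a (w₀ - b - c) c * (R a b c : ℤ) else 0) :=
      boxSum_translate n w₀ (fun a b c => get3 L.tR a b c) (fun a b c => (R a b c : ℤ))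
    have e2 : boxSum n w₀ (fun a b c => if b + c ≤ w₀ then get3 L.tRp a b c * (Rp a (w₀ - b - c) c : ℤ) else 0) =
        boxSum n w₀ (fun a b c => if b + c ≤ w₀ then get3 L.tRp a (w₀ - b - c) c * (Rp a b c : ℤ) else 0) :=
      boxSum_translate n w₀ (fun a b c => get3 L.tRp a b c) (fun a b c => (Rp a b c : ℤ))
    -- the translation clause turns `R a (w₀-b-c) c` into `R a b c`
    have e1' : boxSum n w₀ (fun a b c => if b + c ≤ w₀ then get3 L.tR a b c * (R a (w₀ - b - c) c : ℤ) else 0) =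
        boxSum n w₀ (fun a b c => if b + c ≤ w₀ then get3 L.tR a b c * (R a b c : ℤ) else 0) := by
      unfold boxSum
      refine Finset.sum_congr rfl fun a _ => Finset.sum_congr rfl fun b _ => Finset.sum_congr rfl fun c _ => ?_
      beta_reduce
      split_ifs with hbc
      · rw [← (htr a b c hbc).1]
      · rfl
    have e2' : boxSum n w₀ (fun a b c => if b + c ≤ w₀ then get3 L.tRp a b c * (Rp a (w₀ - b - c) c : ℤ) else 0) =
        boxSum n w₀ (fun a b c => if b + c ≤ w₀ then get3 L.tRp a b c * (Rp a b c : ℤ) else 0) := by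
      unfold boxSum
      refine Finset.sum_congr rfl fun a _ => Finset.sum_congr rfl fun b _ => Finset.sum_congr rfl fun c _ => ?_
      beta_reduce
      split_ifs with hbc
      · rw [← (htr a b c hbc).2]
      · rfl
    have key : boxSum n w₀ (fun a b c =>
        (if b + c ≤ w₀ then get3 L.tR a b c - get3 L.tR a (w₀ - b - c) c else 0) * (R a b c : ℤ) +
        (if b + c ≤ w₀ then get3 L.tRp a b c - get3 L.tRp a (w₀ - b - c) c else 0) * (Rp a b c : ℤ)) =
        (boxSum n w₀ (fun a b c => if b + c ≤ w₀ then get3 L.tR a b c * (R a b c : ℤ) else 0) -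
          boxSum n w₀ (fun a b c => if b + c ≤ w₀ then get3 L.tR a (w₀ - b - c) c * (R a b c : ℤ) else 0)) +
        (boxSum n w₀ (fun a b c => if b + c ≤ w₀ then get3 L.tRp a b c * (Rp a b c : ℤ) else 0) -
          boxSum n w₀ (fun a b c => if b + c ≤ w₀ then get3 L.tRp a (w₀ - b - c) c * (Rp a b c : ℤ) else 0)) := by
      unfold boxSum
      simp only [← Finset.sum_sub_distrib, ← Finset.sum_add_distrib]
      refine Finset.sum_congr rfl fun a _ => Finset.sum_congr rfl fun b _ => Finset.sum_congr rfl fun c _ => ?_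
      split_ifs <;> ring
    rw [key, ← e1, e1', ← e2, e2', sub_self, sub_self, add_zero]
  -- (7) containment rows
  have hcontain : 0 ≤ boxSum n w₀ (fun a b c => get3 L.kap a b c * ((Rp a b c : ℤ) - R a b c)) := by
    unfold boxSum
    refine Finset.sum_nonneg fun a ha => Finset.sum_nonneg fun b hb => Finset.sum_nonneg fun c hc => ?_
    beta_reduce
    by_cases hwt : d ≤ a + b + c
    · have hk : 0 ≤ get3 L.kap a b c := by
        rcases hRRp a (mem_range.1 ha) b (mem_range.1 hb) c (mem_range.1 hc) with ⟨⟨hk, -⟩, -⟩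
        rcases hk with hk | hk
        · exact absurd hwt hk
        · exact hk
      have hge : (R a b c : ℤ) ≤ Rp a b c := by exact_mod_cast hcont a b c
      nlinarith
    · rw [hceq a b c (by omega), sub_self, mul_zero]
  -- (8) the two unit rows
  have hunit : L.zeta * ((R 0 0 0 : ℤ) - 1) + L.ups * ((R 0 w₀ 0 : ℤ) - 1) = 0 := by
    rw [hz0, hzu]; simp
  -- (9) nonpositivity of the coefficient sums
  have hnegABW : ∑ j ∈ range (n + 1), (coefA n k d e path L j * (A j : ℤ) + coefB n k d e path L j * (B j : ℤ) +
      coefW n k d e path L j * (W j : ℤ)) ≤ 0 := by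
    refine Finset.sum_nonpos fun j hj => ?_
    obtain ⟨⟨ha, hb⟩, hw⟩ := hABW j (mem_range.1 hj)
    have hA : (0 : ℤ) ≤ A j := Nat.cast_nonneg _
    have hB' : (0 : ℤ) ≤ B j := Nat.cast_nonneg _
    have hW' : (0 : ℤ) ≤ W j := Nat.cast_nonneg _
    nlinarith
  have hnegR : boxSum n w₀ (fun a b c => coefR n w₀ path L a b c * (R a b c : ℤ) +
      coefRp n k w₀ path L a b c * (Rp a b c : ℤ)) ≤ 0 := by
    refine boxSum_nonpos fun a ha b hb c hc => ?_
    obtain ⟨⟨-, hr⟩, hrp⟩ := hRRp a (mem_range.1 ha) b (mem_range.1 hb) c (mem_range.1 hc)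
    have h1 : (0 : ℤ) ≤ R a b c := Nat.cast_nonneg _
    have h2 : (0 : ℤ) ≤ Rp a b c := Nat.cast_nonneg _
    nlinarith
  -- (10) the grand identity: expand the coefficient sums into the row contributions
  have hexpABW : ∑ j ∈ range (n + 1), (coefA n k d e path L j * (A j : ℤ) + coefB n k d e path L j * (B j : ℤ) +
      coefW n k d e path L j * (W j : ℤ)) =
      ∑ j ∈ range (n + 1), (combA (baseRows n k d e) L.base j * (A j : ℤ) + combB (baseRows n k d e) L.base j * B j +
        combW (baseRows n k d e) L.base j * W j) -
      ∑ j ∈ range (n + 1), L.lamR.getD j 0 * (A j : ℤ) - ∑ j ∈ range (n + 1), L.lamRp.getD j 0 * (B j : ℤ) +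
      ∑ j ∈ range (n + 1), (splitCoef path L.smult (fun s => s.ca.getD j 0) * A j +
        splitCoef path L.smult (fun s => s.cb.getD j 0) * B j + splitCoef path L.smult (fun s => s.cw.getD j 0) * W j) := by
    simp only [coefA, coefB, coefW, ← Finset.sum_sub_distrib, ← Finset.sum_add_distrib]
    refine Finset.sum_congr rfl fun j _ => ?_
    ring
  have hexpR : boxSum n w₀ (fun a b c => coefR n w₀ path L a b c * (R a b c : ℤ) +
      coefRp n k w₀ path L a b c * (Rp a b c : ℤ)) =
      boxSum n w₀ (fun a b c => (if b + c ≤ w₀ then L.lamR.getD (a + b + c) 0 else 0) * (R a b c : ℤ)) +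
      boxSum n w₀ (fun a b c => (if b + c ≤ w₀ then L.lamRp.getD (a + b + c) 0 else 0) * (Rp a b c : ℤ)) +
      boxSum n w₀ (fun a b c =>
        (if b + c ≤ w₀ then (2 : ℤ) ^ (n - k) * (L.pts.map fun q => q.2 * monoAt (n - w₀) w₀ q.1 a b c).sum else 0) *
            Rp a b c +
          (if b + c ≤ w₀ then -(L.pts.map fun q => q.2 * monoAt (n - w₀) w₀ (tPt q.1) a b c).sum else 0) * R a b c) +
      boxSum n w₀ (fun a b c => (if Odd c ∨ w₀ < b + c then get3 L.zR a b c else 0) * (R a b c : ℤ) +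
        (if Odd c ∨ w₀ < b + c then get3 L.zRp a b c else 0) * (Rp a b c : ℤ)) +
      boxSum n w₀ (fun a b c =>
        (if b + c ≤ w₀ then get3 L.tR a b c - get3 L.tR a (w₀ - b - c) c else 0) * (R a b c : ℤ) +
        (if b + c ≤ w₀ then get3 L.tRp a b c - get3 L.tRp a (w₀ - b - c) c else 0) * (Rp a b c : ℤ)) +
      boxSum n w₀ (fun a b c => get3 L.kap a b c * ((Rp a b c : ℤ) - R a b c)) +
      boxSum n w₀ (fun a b c => (if a = 0 ∧ b = 0 ∧ c = 0 then L.zeta else 0) * (R a b c : ℤ) +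
        (if a = 0 ∧ b = w₀ ∧ c = 0 then L.ups else 0) * (R a b c : ℤ)) +
      boxSum n w₀ (fun a b c => splitCoef path L.smult (fun s => get3 s.cr a b c) * R a b c +
        splitCoef path L.smult (fun s => get3 s.crp a b c) * Rp a b c) := by
    simp only [← boxSum_add]
    unfold boxSum
    refine Finset.sum_congr rfl fun a _ => Finset.sum_congr rfl fun b _ => Finset.sum_congr rfl fun c _ => ?_
    beta_reduce
    simp only [coefR, coefRp]
    split_ifs <;> ring
  -- the two unit rows as box sums
  have hunitbox : boxSum n w₀ (fun a b c => (if a = 0 ∧ b = 0 ∧ c = 0 then L.zeta else 0) * (R a b c : ℤ) +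
      (if a = 0 ∧ b = w₀ ∧ c = 0 then L.ups else 0) * (R a b c : ℤ)) = L.zeta * R 0 0 0 + L.ups * R 0 w₀ 0 := by
    rw [boxSum_add, boxSum_ite_eq n w₀ 0 (Nat.zero_le _) L.zeta (fun a b c => (R a b c : ℤ)),
      boxSum_ite_eq n w₀ w₀ le_rfl L.ups (fun a b c => (R a b c : ℤ))]
  -- combine
  have hrhs' : (0 : ℤ) < leafRhs n k d e path L := hrhs
  unfold leafRhs at hrhs'
  linarith [hbase, hspl, hmargR, hmargRp, hpts, hzero, htrans, hcontain, hunit, hnegABW, hnegR, hexpABW, hexpR,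
    hunitbox]

/-- Splits are exhaustive by integrality: at any `(A,B,W,R,R')` one of the two sides of a split holds.
[folklore (integrality ⇒ split disjunction)] -/
theorem rsplit_holds_or (n w₀ : ℕ) (ca cb cw : List ℤ) (cr crp : List (List (List ℤ))) (v : ℤ)
    (A B W : ℕ → ℕ) (R Rp : ℕ → ℕ → ℕ → ℕ) :
    (⟨ca, cb, cw, cr, crp, v, false⟩ : RSplit).Holds n w₀ A B W R Rp ∨
      (⟨ca, cb, cw, cr, crp, v, true⟩ : RSplit).Holds n w₀ A B W R Rp := by
  simp only [RSplit.Holds, RSplit.rhs, RSplit.sgn, Bool.false_eq_true, ↓reduceIte, RSplit.form]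
  set s := ∑ j ∈ range (n + 1), (ca.getD j 0 * (A j : ℤ) + cb.getD j 0 * B j + cw.getD j 0 * W j) +
    boxSum n w₀ fun a b c => get3 cr a b c * (R a b c : ℤ) + get3 crp a b c * Rp a b c
  rcases le_or_gt s v with h | h
  · left; linarith
  · right; linarith

/-- **Soundness of the refined tree checker**. Column: proved (ours). [cite: MacWilliamsSloane1977, Ch. 17 §4 Thm. 20] -/
theorem not_leafHyp_of_checkPath (t : RTree) {path : List RSplit} (h : t.checkPath n k d e w₀ path = true)
    (H : LeafHyp n k d e w₀ path A B W R Rp) : False := by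
  induction t generalizing path with
  | leaf L => exact not_leafHyp_of_rleafOK h H
  | split ca cb cw cr crp v le ge ihl ihg =>
    simp only [RTree.checkPath, Bool.and_eq_true] at h
    rcases rsplit_holds_or n w₀ ca cb cw cr crp v A B W R Rp with hl | hg
    · refine ihl h.1 ⟨H.sys, H.ref, fun s hs => ?_⟩
      rcases List.mem_append.1 hs with hs | hs
      · exact H.path s hs
      · rw [List.mem_singleton.1 hs]; exact hl
    · refine ihg h.2 ⟨H.sys, H.ref, fun s hs => ?_⟩
      rcases List.mem_append.1 hs with hs | hs
      · exact H.path s hs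
      · rw [List.mem_singleton.1 hs]; exact hg

/-- **Two checked refined certificates (one per parity branch) refute the refined system** — UNCONDITIONAL (weak
duality + integrality). Column: proved (ours). [cite: CalderbankEtAl1998, §7 (ii) (printed p. 28)] -/
theorem not_crssRefinedFeasible_of_check (t₀ t₁ : RTree) (h₀ : t₀.check n k d 0 w₀ = true)
    (h₁ : t₁.check n k d 1 w₀ = true) : ¬ CRSSRefinedFeasible n k d w₀ := by
  rintro ⟨A, B, W, e, R, Rp, hsys, href⟩
  have he := hsys.1
  interval_cases e
  · exact not_leafHyp_of_checkPath (path := []) t₀ h₀ ⟨hsys, href, fun s hs => by simp at hs⟩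
  · exact not_leafHyp_of_checkPath (path := []) t₁ h₁ ⟨hsys, href, fun s hs => by simp at hs⟩

end Soundness

/-! ### 5. Assembly: CRSS's two-stage argument -/

/-- **CRSS's two-stage special-bound argument, certified.** Let `zs` be a list of weights. If (a) the plain integer
system together with `A_w = 0` for all `w ∈ zs` is refuted by checked certificates in both parity branches («linear
programming shows that `C` must contain a vector of weight» in `zs`), and (b) for every `w ∈ zs` the system refined
with respect to a codeword of weight `w` is refuted in both branches («adding these constraints to the refined weight
enumerator produces a linear program with no feasible solution»), then there is no `[[n,k,d]]` additive code whose
stabilizer space has no word of weight `1`. Column: proved (ours).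
[cite: CalderbankEtAl1998, §7 (ii) (printed p. 28)] -/
theorem no_additiveCode_of_certs {n k d : ℕ} (zs : List ℕ) (t₀ t₁ : IPTree) (h₀ : t₀.checkZ n k d 0 zs = true)
    (h₁ : t₁.checkZ n k d 1 zs = true) (href : ∀ w ∈ zs, ¬ CRSSRefinedFeasible n k d w)
    (S : Submodule (ZMod 2) (SympVec n)) (hS : IsAdditiveCode S k d) (hw1 : ∀ v ∈ S, sympWeight v ≠ 1) : False := by
  classical
  have hsys := hS.crssIntSystem hw1
  have hz : ∀ w ∈ zs, wtDist S w = 0 := fun w hw => hS.wtDist_eq_zero_of_not_crssRefinedFeasible hw1 (href w hw)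
  have he := hsys.1
  rcases Nat.le_one_iff_eq_zero_or_eq_one.1 he with he0 | he1
  · rw [he0] at hsys; exact not_sat_checkZ h₀ hsys hz
  · rw [he1] at hsys; exact not_sat_checkZ h₁ hsys hz

/-- The column step with the two-stage certificates: if no `[[m,k,d]]` exists, and the two-stage certificates refute
`[[m+1,k,d′]]` codes without weight-one stabilizer words, `d ≤ d′`, then no `[[m+1,k,d′]]` exists (Thm. 6 (e)).
Column: proved (ours). [cite: CalderbankEtAl1998, §4 Thm. 6 (e), §7 (ii)] -/
theorem not_additiveCodeExists_succ_of_certs {m k d d' : ℕ} (hprev : ¬ AdditiveCodeExists m k d) (hdd : d ≤ d')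
    (hno : ∀ S : Submodule (ZMod 2) (SympVec (m + 1)), IsAdditiveCode S k d' → (∀ v ∈ S, sympWeight v ≠ 1) → False) :
    ¬ AdditiveCodeExists (m + 1) k d' := by
  intro h
  rcases h.noWeightOne_or_shorten with ⟨S, hS, hw⟩ | h'
  · exact hno S hS hw
  · obtain ⟨S, hS⟩ := h'
    exact hprev ⟨S, hS.mono hdd⟩

end Summit.Ventures.QEC.Census
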